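import Summits.QuantumFields.Balaban3D.Carriers.Series
import Summits.QuantumFields.Balaban3D.Carriers.Masses
import Literature.MathematicalPhysics.QuantumFieldTheory.Balaban1983to89.B10StarCount

/-!
# Lane `pub-balaban3d` — carrier layer p1 (`Carriers.Standard`): THE STANDARD TOWER INPUT of the lane (rulings R-FL′ / R-COL / R-MASS /
# R-Z / R-NORM / R-RN): besides print's EXTERNAL INPUTS (`ExternalInputs`: the averaging `Ū` of [4] with its measurability and Haar
# compatibility, the regular classes and minimizers of [7]), the carrier CONSTANTS (`CarrierConsts`, values from seat p3) and the
# EXPANSION DATA (`StepSeries`), EVERY tower field is a DEFINITION — masses `histWeights3`, collar `⌈R₁ r(g_k)⌉M₁`, thresholds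
# `g_kp(g_k)` / `2L²g_{k−1}p(g_{k−1})`, coefficients `CZ_j`, `CR g^{6+2κ₀}`, the step parameters `|B(Λ_{k+1})*|`, `|T₁^{(k)*|`,
# `(g_k²)^{3+κ₀}|T₁^{(k)}|` (v1.1c), and the R-RN BARRIERS = the printed step bounds (55)/(57) themselves (v1.2)

v1.2 (this seat, 2026-08-22): the sandwich barriers of the version selection (ruling R-RN) are no longer free data: `upperOf` IS the right-hand
side of the upper step bound (55)·(58) p. 269–270 — `LF_{k+1}(V)[−(1/g_{k+1}²)A^η(U_{k+1}(h,V)) − E_k + (log σ₀ + d(𝔤)log g_k)|B(Λ_{k+1})*|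
+ log Z^{(k)} + Σ𝒫_j + Z-terms + remainders + log(fluctuation integral)]` — and `lowerOf` IS the lower step bound at the trivial
history (p. 272 L32–33 / (47)), both DEFINED in `Carriers.Series` (`TowerBase.lowerOf`/`upperOf`, read off a barrier-free pre-tower); seat p4's pinning hypotheses
`hupper`/`hlower` of `Bound55Tower.bound55_of_select` / `bound55Lower_of_select` hold for `stdTowerInput` BY `rfl` (`stdTowerInput_upper`,
`stdTowerInput_lower`); `ExternalInputs` carries the averaging's measurability + Haar compatibility instead of `AvgAC` + barriers.  [folklore] bookkeeping;
nothing of CMP 102 is asserted.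
-/

open MeasureTheory

namespace Summit.QuantumFields.Balaban3D.Carriers

open Literature.MathematicalPhysics.QuantumFieldTheory.Balaban1983to89
open Literature.MathematicalPhysics.QuantumFieldTheory.Balaban1985CMP102
open Literature.MathematicalPhysics.QuantumFieldTheory.Balaban1985CMP102.Setting

variable {L : ℕ} {S : Scales L} {G : Type} [GaugeGroup G] [MeasurableSpace G] [HaarData G]

/-! ## §4 R-FL′ / R-COL / R-MASS / R-RN: everything but the external inputs and the expansion data is a DEFINITION -/

section Standard

/-- THE EXTERNAL INPUTS of print at tower level (ruling R-FL′: the ONLY free fields besides the expansion data `StepSeries`), v1.2: the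
averaging `Ū` of [4] with its MEASURABILITY and HAAR COMPATIBILITY `Ū_*(dU) = dV` ([Balaban1985Averaging] (10) p. 19, the normalisation
«∫dV δ(VŪ⁻¹) = 1» of the printed transformation; theorems for the lane's standard axial family, `ofStd`; NOT IN PRINT for the non-linear
average (15), seat finding F-p1-2 / LEAF-LEDGER E6), the regular classes and minimizers `U_k`, `U_k(·,h)` of [7] Thm 1 / (42) (binder b11).
The R-RN barriers are no longer inputs (v1.2: `Carriers.Series` `TowerBase.lowerOf`/`upperOf`). [cite: Balaban1985UV3, (2) p.256 + (42) p.266; Balaban1985Averaging, (10) p.19] -/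
structure ExternalInputs {L : ℕ} (S : Scales L) (G : Type) [GaugeGroup G] [MeasurableSpace G] [HaarData G] where
  /-- `Ū` of [4], per level -/
  av : ∀ j, Averaging S.P j G
  /-- `Ū` is measurable (E6 (a)) -/
  av_meas : ∀ j, Measurable (av j).avg
  /-- `Ū` is Haar compatible: `Ū_*(dU) = dV` (E6 (b); [4] (10) p. 19) -/
  av_map : ∀ j, (fieldMeasure S.P j G).map (av j).avg = fieldMeasure S.P (j + 1) G
  /-- regular classes of [7] -/
  reg : ℕ → Set (GaugeField S.P 0 G)
  /-- minimizers `U_k(V)` of [7] Thm 1, `k ≥ 1` -/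
  Uk : (k : ℕ) → GaugeField S.P (k + 1) G → GaugeField S.P 0 G
  /-- composite minimizers `U_k(V, h)` of (42) -/
  UkH : (k : ℕ) → Hist S.P k → GaugeField S.P k G → GaugeField S.P 0 G
  /-- (42) at the trivial history -/
  UkH_triv : ∀ (k : ℕ) (V : GaugeField S.P k G), UkH k (Hist.triv S.P k) V = ukAll Uk k V

/-- D-1a / E6 for external inputs: measurability + Haar compatibility give `AvgAC` (absolute continuity of the push-forward). [folklore] -/
theorem ExternalInputs.avgAC (X : ExternalInputs S G) (j : ℕ) : AvgAC (X.av j).avg :=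
  AvgAC.of_map_eq (X.av_meas j) (X.av_map j)

/-- **E6 EXIT FOR THE LANE'S STANDARD AVERAGING FAMILY** (LEAF-LEDGER §E E6): external inputs built over LQB's total axial family
`AveragingRT.stdAvg` (the factor `U(c)` of [Balaban1985Averaging] (15); axial in the standing range, a relabelling beyond) carry their
measurability and Haar compatibility as THEOREMS (`stdAvg_measurable`, `stdAvg_map`, RT.lean §5), for EVERY gauge group with measurable
multiplication (every `GroupModel`) — the averaging MAP is constrained, not the group.  Only for the full non-linear average (15) (matrix
`log`) do `av_meas`/`av_map` remain binders (F-p1-2: NOT IN PRINT). [cite: Balaban1985Averaging, (10) + (15) p.19] -/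
noncomputable def ExternalInputs.ofStd [MeasurableMul₂ G] (reg : ℕ → Set (GaugeField S.P 0 G))
    (Uk : (k : ℕ) → GaugeField S.P (k + 1) G → GaugeField S.P 0 G)
    (UkH : (k : ℕ) → Hist S.P k → GaugeField S.P k G → GaugeField S.P 0 G)
    (UkH_triv : ∀ (k : ℕ) (V : GaugeField S.P k G), UkH k (Hist.triv S.P k) V = ukAll Uk k V) : ExternalInputs S G where
  av := AveragingRT.stdAvg S.P G
  av_meas := stdAvg_measurable
  av_map := stdAvg_map
  reg := reg
  Uk := Uk
  UkH := UkH
  UkH_triv := UkH_triv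

/-- The standard external inputs average by `stdAvg` (definitional). [folklore] -/
theorem ExternalInputs.ofStd_av [MeasurableMul₂ G] (reg : ℕ → Set (GaugeField S.P 0 G))
    (Uk : (k : ℕ) → GaugeField S.P (k + 1) G → GaugeField S.P 0 G)
    (UkH : (k : ℕ) → Hist S.P k → GaugeField S.P k G → GaugeField S.P 0 G)
    (UkH_triv : ∀ (k : ℕ) (V : GaugeField S.P k G), UkH k (Hist.triv S.P k) V = ukAll Uk k V) :
    (ExternalInputs.ofStd reg Uk UkH UkH_triv).av = AveragingRT.stdAvg S.P G := rfl

/-- THE CARRIER CONSTANTS the definitions below consume (values supplied by seat p3's constants record, R-CONST): `M₁` (big blocks),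
`R₁, r₀` ((7)/(39): `R(g) = R₁ r(g)`), `b₀, p₀` ((7): `p(g)`), `κ₀` (remainders), the gathered Z-term constants `Cz, Cv, C₅, C₆, c₁` and
`log σ₀`, `d(𝔤)` (R-Z / C13), the remainder constant `CR` (R-NORM / C14). [cite: Balaban1985UV3, (7) p.257 + (39) p.266] -/
structure CarrierConsts where
  /-- big-block size -/
  M₁ : ℕ
  /-- `R₁` of `R(g) = R₁ r(g)` -/
  R₁ : ℝ
  /-- `r₀` of `r(g) = (1 + log g⁻¹)^{r₀}` -/
  r₀ : ℝ
  /-- `b₀` of `p(g)` -/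
  b₀ : ℝ
  /-- `p₀` of `p(g)` -/
  p₀ : ℝ
  /-- `κ₀` of the remainders -/
  κ₀ : ℝ
  /-- cumulant constant `Cz` ((58), `Cumulant58`) -/
  Cz : ℝ
  /-- vacuum constant `Cv` (`VacuumWhole`) -/
  Cv : ℝ
  /-- `C₅` (`Norm35`) -/
  C₅ : ℝ
  /-- `C₆` (`OldOutside`) -/
  C₆ : ℝ
  /-- `c₁` (`StarCount`) -/
  c₁ : ℝ
  /-- `log σ₀` ((18) p. 260) -/
  logσ₀ : ℝ
  /-- `d(𝔤)` -/
  dg : ℝ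
  /-- `d(𝔤) ≥ 0` (a dimension; v1.1c for `piecesParamsOf`) -/
  dg_nonneg : 0 ≤ dg
  /-- remainder constant `CR` (R-NORM) -/
  CR : ℝ

variable (S)

/-- R-COL: the collar profile `⌈R₁ r(g_k)⌉ · M₁` ((39) p. 266 «R(g_j)M₁, R(g_j) = R₁r(g_j)»). [cite: Balaban1985UV3, (39) p.266] -/
noncomputable def rcolOf (K : CarrierConsts) (k : ℕ) : ℕ := ⌈K.R₁ * B10.rFun K.r₀ (S.gk k)⌉₊ * K.M₁

/-- R-OMEGA / reading D-RET: the RETAINED RADIUS profile `R(g_k) = R₁ r(g_k)` ((39) p. 266, (59) p. 270 L32–35; 𝓛 counting `M₁`-blocks). [cite: Balaban1985UV3, (59) p.270] -/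
noncomputable def rretOf (K : CarrierConsts) (k : ℕ) : ℝ := K.R₁ * B10.rFun K.r₀ (S.gk k)

/-- R-OMEGA / R-CUBE: the number of big blocks per direction of the unit lattice `T^{(k)}`, `⌊(sites per direction)/M₁⌋`, at least `1` (so that
LQB's torus block carrier `tsys 3 (nblkOf S K k)` is never empty; print has `M₁ ∣ 2L^{m+K−k}`, p. 266 (39)). [cite: Balaban1985UV3, (39) p.266] -/
def nblkOf (K : CarrierConsts) (k : ℕ) : ℕ := max 1 (S.P.sitesPerDir k / K.M₁)

/-- `nblkOf` is never zero. [folklore] -/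
instance nblkOf_neZero (K : CarrierConsts) (k : ℕ) : NeZero (nblkOf S K k) :=
  ⟨Nat.pos_iff_ne_zero.1 (lt_of_lt_of_le Nat.one_pos (le_max_left _ _))⟩

/-- (4)/(7) p. 257: `ε₁ = g_k p(g_k)` at step `k` (also the large-field threshold `εL` of the masses). [cite: Balaban1985UV3, (7) p.257] -/
noncomputable def eps1Of (K : CarrierConsts) (k : ℕ) : ℝ := S.gk k * B10.pFun K.b₀ K.p₀ (S.gk k)

/-- (40) p. 266: the small-field threshold `2L²g_{k−1}p(g_{k−1})` of `χ_k` (the `εS` of the masses). [cite: Balaban1985UV3, (40) p.266] -/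
noncomputable def epsSOf (K : CarrierConsts) (k : ℕ) : ℝ := 2 * (L : ℝ) ^ 2 * (S.gk (k - 1) * B10.pFun K.b₀ K.p₀ (S.gk (k - 1)))

/-- R-Z (R-PIECES (d), C13): the Z-term coefficient `CZ_j = (Cz+Cv)g_j + C₅ + C₆ + (|log σ₀| + d(𝔤) log g_j⁻¹)c₁` («O(log g_j⁻¹)»). [cite: Balaban1985UV3, (41) p.266] -/
noncomputable def zcoefOf (K : CarrierConsts) (j : ℕ) : ℝ :=
  (K.Cz + K.Cv) * S.gk j + K.C₅ + K.C₆ + (|K.logσ₀| + K.dg * Real.log (S.gk j)⁻¹) * K.c₁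

/-- R-NORM (C14): the remainder coefficient `CR · g^{6+2κ₀}` (j-independent). [cite: Balaban1985UV3, (41) p.266] -/
noncomputable def rcoefOf (K : CarrierConsts) (_j : ℕ) : ℝ := K.CR * S.g ^ ((6 : ℝ) + 2 * K.κ₀)

/-- **THE STEP PARAMETERS DEFINED** (v1.1c, R-FL′ «no free real-valued field»; rows C9 / p3's `starT_eq`, `rem_eq`, `logσ₀_le`, `dg_le`):
`starB h := |B(Λ_{k+1}(h))*|` = LQB `B10StarCount.starCount (LamFin …)` (p. 269 L20 / p. 260), `starT := |T₁^{(k)*|` = `starCount univ`,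
`logσ₀, d(𝔤)` from the constants, `rem := (g_k²)^{3+κ₀}|T₁^{(k)}|` (R-NORM, p3's `rem_eq` literally).  With these, seat p3's
`starCount_leaf_run3` hypotheses `hT`/`hB` and the end-list equations `starT_eq`/`rem_eq` hold by `rfl`. [cite: Balaban1985UV3, (55) p.269 + (62) p.271] -/
noncomputable def piecesParamsOf (K : CarrierConsts) (k : ℕ) : PiecesParams S k where
  starB h := (B10StarCount.starCount (LamFin K.M₁ (rcolOf S K) k h) : ℝ)
  starT := (B10StarCount.starCount (Finset.univ : Finset (Site S.P (k + 1))) : ℝ)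
  logσ₀ := K.logσ₀
  dg := K.dg
  dg_nonneg := K.dg_nonneg
  rem := (S.gk k ^ 2) ^ (3 + K.κ₀) * S.sites k
  rem_nonneg := mul_nonneg (Real.rpow_nonneg (sq_nonneg _) _) (by
    -- `|T₁^{(k)}| ≥ 0` (the one filed copy of this fact is seat p3's `ScalesArithmetic.sites_nonneg`, ruling R-DEDUP′)
    unfold Scales.sites B10.sitesRun Scales.volT
    have hε := S.ε_pos
    have hL : (0 : ℝ) < (L : ℝ) := by have := S.hL.2; exact_mod_cast (by omega : 0 < L)
    positivity)

/-- `piecesParamsOf`: the star count of the step is the torus count (p3's `starT_eq`, `rfl`). [folklore] -/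
theorem piecesParamsOf_starT (K : CarrierConsts) (k : ℕ) :
    (piecesParamsOf S K k).starT = (B10StarCount.starCount (Finset.univ : Finset (Site S.P (k + 1))) : ℝ) := rfl

/-- `piecesParamsOf`: `starB h = |B(Λ_{k+1}(h))*|` on `Carriers.LamFin` (p3's `hB`, `rfl`). [folklore] -/
theorem piecesParamsOf_starB (K : CarrierConsts) (k : ℕ) (h : Hist S.P (k + 1)) :
    (piecesParamsOf S K k).starB h = (B10StarCount.starCount (LamFin K.M₁ (rcolOf S K) k h) : ℝ) := rfl

/-- `piecesParamsOf`: the remainder unit is `(g_k²)^{3+κ₀}|T₁^{(k)}|` (p3's `rem_eq`, `rfl`). [folklore] -/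
theorem piecesParamsOf_rem (K : CarrierConsts) (k : ℕ) :
    (piecesParamsOf S K k).rem = (S.gk k ^ 2) ^ (3 + K.κ₀) * S.sites k := rfl

variable {S}

/-- **THE STANDARD TOWER BASE** over external inputs and constants (R-FL′): `W := histWeights3 …` (R-MASS), `Rcol := rcolOf` (R-COL),
`ε₁ := eps1Of`, `zcoef := zcoefOf`, `rcoef := rcoefOf`, `Rret := rretOf` (R-OMEGA), `M₁/b₀/p₀/κ₀ := K.…`; `avgAC` from measurability + Haar
compatibility (v1.2).
[cite: Balaban1985UV3, (38)–(41) p.266] -/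
noncomputable def ExternalInputs.toTowerBase (X : ExternalInputs S G) (K : CarrierConsts) : TowerBase S G where
  ε₁ := eps1Of S K
  av := X.av
  avgAC := X.avgAC
  reg := X.reg
  Uk := X.Uk
  M₁ := K.M₁
  Rcol := rcolOf S K
  Rret := rretOf S K
  b₀ := K.b₀
  p₀ := K.p₀
  κ₀ := K.κ₀
  W := histWeights3 K.M₁ (rcolOf S K) (eps1Of S K) (epsSOf S K) X.av
  UkH := X.UkH
  UkH_triv := X.UkH_triv
  zcoef := zcoefOf S K
  rcoef := rcoefOf S K

/-- **THE TOWER INPUT OF THE LANE over given step parameters** (R-FL′): external inputs, constants, expansion data, parameters `C` — `Pint`,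
`E^{(k)}` and the R-RN barriers DEFINED by `TowerBase.withSeries` (v1.2). [cite: Balaban1985UV3, (38)–(43) p.266 + (62) p.271] -/
noncomputable def towerInputOf {V : Type} [NormedAddCommGroup V] [NormedSpace ℂ V] {Nc : ℕ → ℕ} [∀ k, NeZero (Nc k)]
    (X : ExternalInputs S G) (K : CarrierConsts) (𝔖 : ∀ k, StepSeries S G V (Nc k) k) (C : ∀ k, PiecesParams S k) : TowerInput S G :=
  (X.toTowerBase K).withSeries 𝔖 C

/-- The end theorem's construction family member (PLAN §0.5 E4 pointer): `towerWith (towerInputOf …) ⊤`; its `pin` is `tower3`. [folklore] -/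
theorem tower3_towerInputOf {V : Type} [NormedAddCommGroup V] [NormedSpace ℂ V] {Nc : ℕ → ℕ} [∀ k, NeZero (Nc k)]
    (X : ExternalInputs S G) (K : CarrierConsts) (𝔖 : ∀ k, StepSeries S G V (Nc k) k) (C : ∀ k, PiecesParams S k) :
    (towerInputOf X K 𝔖 C).tower3 = ((towerInputOf X K 𝔖 C).towerWith fun _ => True).pin := rfl

section Std

variable {V : Type} [NormedAddCommGroup V] [NormedSpace ℂ V]
  (X : ExternalInputs S G) (K : CarrierConsts) (𝔖 : ∀ k, StepSeries S G V (nblkOf S K k) k)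

/-- **THE STANDARD TOWER INPUT OF THE LANE** (v1.1c/v1.2): external inputs + constants + expansion data; the step parameters by
`piecesParamsOf`, the barriers by `TowerBase.lowerOf`/`upperOf`, `Pint`/`E^{(k)}` by the series — NO free per-step real data and no free
barrier, the block counts by `nblkOf` (R-OMEGA), the chart values in `V` (R-32′: the END THEOREM takes `V := 𝔤ᶜ` of the group model).  The E4
family member is `mkT G 𝔊 S := towerWith (stdTowerInput (X G 𝔊 S) K (𝔖 G 𝔊 S)) ⊤` (its `pin` is `tower3`); seat p3's `Inputs.inputOf 𝔎 X 𝔖`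
is this at `K := 𝔎.carrier` (definitionally). [cite: Balaban1985UV3, (38)–(43) p.266 + (55) p.269 + (62) p.271] -/
noncomputable def stdTowerInput : TowerInput S G :=
  towerInputOf X K 𝔖 (piecesParamsOf S K)

/-- `stdTowerInput` is `towerInputOf` at `piecesParamsOf` (definitional). [folklore] -/
theorem stdTowerInput_eq : stdTowerInput X K 𝔖 = towerInputOf X K 𝔖 (piecesParamsOf S K) := rfl

/-- The standard tower's `M₁` is the constant's (definitional). [folklore] -/
theorem stdTowerInput_M₁ : (stdTowerInput X K 𝔖).M₁ = K.M₁ := rfl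

/-- The standard tower's collar profile is `rcolOf` (definitional). [folklore] -/
theorem stdTowerInput_Rcol : (stdTowerInput X K 𝔖).Rcol = rcolOf S K := rfl

/-- The standard tower's retained radius is `rretOf` (R-OMEGA; p6's `hRret`, `rfl`). [folklore] -/
theorem stdTowerInput_Rret (k : ℕ) : (X.toTowerBase K).Rret k = K.R₁ * B10.rFun K.r₀ (S.gk k) := rfl

/-- **Seats p5/p6's `hZ` at the standard tower — a THEOREM** (R-OMEGA″): `#(blocks ∖ Ω_{k+1}(h)) ≤ |Z_k(h)|` (`Carriers.seriesPieces_hZ`). [cite: Balaban1985UV3, p.270 L31] -/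
theorem stdTowerInput_hZ (k : ℕ) (h : Hist S.P (k + 1)) :
    (((Finset.univ : Finset (TreeLengthTorus.TPt 3 (nblkOf S K k))) \ ΩblkOf K.M₁ (rcolOf S K) (nblkOf S K k) h).card : ℝ) ≤
      (seriesPieces (X.toTowerBase K) 𝔖 (piecesParamsOf S K) k).Zvol h :=
  seriesPieces_hZ (X.toTowerBase K) 𝔖 (piecesParamsOf S K) k h

/-- **Seat p4's `hupper` BY `rfl` for the standard tower** (any slot): the upper barrier IS the right-hand side of (55)·(58) with the DEFINED
star counts `|B(Λ_{k+1}(h))*| = starCount (LamFin …)`. [cite: Balaban1985UV3, (55) p.269 + (58) p.270] -/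
theorem stdTowerInput_upper (slot : ℕ → Prop) (k : ℕ) (U : GaugeField S.P (k + 1) G) :
    (stdTowerInput X K 𝔖).upper k U =
      ((stdTowerInput X K 𝔖).towerWith slot).LF (k + 1) U (fun h' =>
        -(((stdTowerInput X K 𝔖).towerWith slot).mainT (k + 1) h' U) - ((stdTowerInput X K 𝔖).towerWith slot).Ecst k
        + (K.logσ₀ + K.dg * Real.log (S.gk k)) * (B10StarCount.starCount (LamFin K.M₁ (rcolOf S K) k h') : ℝ)
        + (𝔖 k).logZU h' U + (𝔖 k).Pold K.M₁ (rcolOf S K) h' U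
        + ((stdTowerInput X K 𝔖).towerWith slot).Zterm k (Hist.proj h') + ((stdTowerInput X K 𝔖).towerWith slot).Rm k
        + (𝔖 k).logFl h' U) := rfl

/-- **Seat p4's `hlower` BY `rfl` for the standard tower** (any slot), with `|T₁^{(k+1)*|`-star count `starCount (LamFin … triv)`
(= `starCount univ` in the standing range, `lamFin_triv`). [cite: Balaban1985UV3, p.272 L32–33 + (47) p.267] -/
theorem stdTowerInput_lower (slot : ℕ → Prop) (k : ℕ) (U : GaugeField S.P (k + 1) G) :
    (stdTowerInput X K 𝔖).lower k U =
      ((stdTowerInput X K 𝔖).towerWith slot).chi (k + 1) U *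
        Real.exp (-(((stdTowerInput X K 𝔖).towerWith slot).mainT (k + 1) (Hist.triv S.P (k + 1)) U)
          - ((stdTowerInput X K 𝔖).towerWith slot).Ecst k
          + (K.logσ₀ + K.dg * Real.log (S.gk k))
            * (B10StarCount.starCount (LamFin K.M₁ (rcolOf S K) k (Hist.triv S.P (k + 1))) : ℝ)
          + (𝔖 k).logZU (Hist.triv S.P (k + 1)) U + (𝔖 k).Pold K.M₁ (rcolOf S K) (Hist.triv S.P (k + 1)) U
          - ((stdTowerInput X K 𝔖).towerWith slot).Rm k + (𝔖 k).logFl (Hist.triv S.P (k + 1)) U) := rfl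

/-- **Seat p2's `hW` for the standard tower input** (`lf_dominated_adm` / `lf_tower3_adm`, lead batch 13 (e)): the constructed masses vanish,
POINTWISE, on inadmissible histories. [folklore] -/
theorem stdTowerInput_mass_eq_zero_of_not_admissible (k : ℕ) (h : Hist S.P k) (U : GaugeField S.P k G)
    (hh : ¬ Hist.Admissible (stdTowerInput X K 𝔖).M₁ (stdTowerInput X K 𝔖).Rcol k h) :
    (stdTowerInput X K 𝔖).W.mass k h U = 0 :=
  histWeights3_mass_eq_zero_of_not_admissible _ _ _ _ _ k h U hh

/-- **Seat p4's `hmt` for the standard tower input**: the trivial history has mass `1`, pointwise. [folklore] -/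
theorem stdTowerInput_mass_triv (k : ℕ) (U : GaugeField S.P k G) :
    (stdTowerInput X K 𝔖).W.mass k (Hist.triv S.P k) U = 1 :=
  massRec_triv _ _ _ _ _ k U

/-- **Seat p4's `hmeas` for the standard tower input**: the masses are measurable. [folklore] -/
theorem stdTowerInput_mass_measurable (k : ℕ) (h : Hist S.P k) : Measurable ((stdTowerInput X K 𝔖).W.mass k h) :=
  measurable_massRec _ _ _ _ _ k h

/-- Seat p4's `havg`/`hmap` for the standard tower input: the averaging is measurable and Haar compatible (fields of `ExternalInputs`). [folklore] -/
theorem stdTowerInput_av_map (j : ℕ) :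
    Measurable ((stdTowerInput X K 𝔖).av j).avg ∧
      (fieldMeasure S.P j G).map ((stdTowerInput X K 𝔖).av j).avg = fieldMeasure S.P (j + 1) G :=
  ⟨X.av_meas j, X.av_map j⟩

end Std

end Standard

end Summit.QuantumFields.Balaban3D.Carriers
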